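import Literature.MathematicalPhysics.QuantumFieldTheory.Balaban1983to89.B9Thm313WholeDvAtPinsR
import Literature.MathematicalPhysics.QuantumFieldTheory.Balaban1983to89.B9Thm313WholeDir
import Literature.MathematicalPhysics.QuantumFieldTheory.Balaban1983to89.B9BackgroundsKLevelV1R
import Literature.MathematicalPhysics.QuantumFieldTheory.Balaban1983to89.B9CoReadingCoordsHolderAdm
import Literature.MathematicalPhysics.QuantumFieldTheory.Balaban1983to89.B9RWSums347DefiniteFaces

/-!
# BalabanUVNodes ∕ N06 ([B9], `Dag.B9_main`) — THE DISPLAYED D_U-RIGHT LETTERS OF ROWS 20–21 OF THE STAGE-11 CERTIFICATE (`hZ1` = G₀D_U : 𝔠_W⁽¹⁾ → 𝔠⁽²⁾,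
# `hpXDv` = Φ^X_βG₀D_U : 𝔠_W⁽⁰⁾ → 𝔠_P^{(β−1)}, and `hLL2`'s block-L² fields `gDv ∕ dGDv ∕ dGDvd ν` = G₀D_U, ∇_UG₀D_U, ∇_{U,ν}G₀D_U) DERIVED AT THE PINS from the
# certificate's OWN G₀ layer (`Thm33G0DirR.e2d`, `Thm33G0L2M.l2d ∕ l4m`, `Thm33G0Dir.h43R` at rate δ12₀) and ONE STRICT budget line `δ12₃ < δ12₀` —
# member-uniformly, with produced threshold and constants, at rate δ12₃; the [4] (2.60)∕(2.61) member facts are DISCHARGED inside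

Track A of `YM-PLAN.md` (cell `pub-ymgap`, HUMAN RULING D-0062), node **N06** = [Balaban1985BackgroundPropagators] Thms 3.1–3.15; rows 20–21, seat
`pub-ymgap-dag-n06-c` (g21; LOCATED-23, cell INBOX 2026-08-29 23:21Z); dag-n06-d's `DISPLAY-LEDGER-UF.md` §2 (row «G₀ smooth-source members», the D_U part) and
dag-n06-l's `DISPLAY-LEDGER-ROWS2021.md` §6∕§7.  A HELPER for dag-n06-d's certificate editions after ED.93 «UT» (`…BalabanUVNodesN06AtOpsYNuOfRecordV6EPairUT`).
WHY.  Editions ≥ 85 display `hZ1 : … HasMaj 𝔠_W⁽¹⁾ 𝔠⁽²⁾ (G₀∘D_U) (B12₃e^{−δ12₃d})`, `hpXDv : … ∀ β, HasMaj 𝔠_W⁽⁰⁾ 𝔠_P^{(β−1)} (Φ^X_β∘G₀∘D_U) (Bx13 β·e^{−δ12₃d})` and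
`hLL2 : … Letters313L2Pk … ∧ Letters313L2MZ …` (block-L² fields `gDv`, `dGDv`, `dGDvd ν` among others, constant `B13₄`, rate `δ12₃`), although they DERIVE the G₀
layer `hG0C x … : Thm33G0Dir … ∧ Thm33G0DirR (𝔬12 x) (𝔡A x).Dsd 1 (H x) B12₀ δ12₀ U ∧ Thm33G0L2M (𝔬12 x) (𝔡A x).Dd (𝔡A x).Dsd 1 (H x) B12₂ δ12₀ U`
(`…N06G0LayerFromThm310AtPinsGUS.g0_layer_of_thm310_coreDir₃US`) and hold the pins `h𝔬12` (def-Y's Sect.-D record: `hblk12 hblkW12 hblkY12 hG0co12 hDco12 hDsco12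
hDvco12`), `h𝔡Ad ∕ h𝔡As` (direction letters), `h𝔭A` (Hölder probes = the `Adm`-cut carrier `holderProbesKA`), `hβ1` (1-faithful block map) and the class axiom `hGR`
(«`U` is SU(N)-valued»).  At node00-def-Y's letters the covariant gradient of the gauge sector is D_U = Σ_μ ∇\*_{U,μ}∘J_μ (dag-n06-l `B9GradViaDivLettersAtPins.DvcoKH_eq_sum`;
(3.3) p. 390, (3.8) p. 392), so the five displayed letters are the DIRECTIONAL right entries of Theorem 3.3 for G₀ composed with the kinematic letter J_μ (dag-n06-l
g17 `B9Thm313WholeDvFromDds`), the probe one after dag-n06-w5's slice relabelling — all carrier-generic since `B9Thm313WholeDvAtPinsR` (this seat, the twin of dag-n06-l's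
`bg9Y`-only packages).  THIS FILE discharges the member facts at the geometry of record (`facts347_exp261_geo9Y` with `α := ½`, `δ_F := 2(δ12₀ − δ12₃) > 0`, `L₀ := ℓ+1`,
above a produced threshold — only `gD2` pays the p.-398 transfer), the row sums by `rowSum261_geo9Y` at rate 1, reads the contraction of the link variables off `hGR`, and
packages everything in the certificate's binder shapes: ★★★ `dv_letters_of_pins` — ∃ `MD ≥ M12`, `BZ ≥ 0`, `BX ≥ 0` (a β-profile), `BL ≥ 0` such that above `MD` and
in the layer's regime: `hZ1`'s letter at `(BZ, δ12₃)`, `hpXDv`'s family at `(BX β, δ12₃)`, and `gDv ∕ dGDv ∕ dGDvd ν` at `(BL, δ12₃)`.  Budget: exactly the STRICT line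
`hδ₃₀ : δ12₃ < δ12₀` already displayed (ED.85); no other numeric.  The knit (dag-n06-d's pen): `B12₃ := max B12₃ BZ`, `Bx13 := fun β => max (Bx13 β) (BX β)`,
`B13₄ := max B13₄ BL` as in ED.85∕91∕93; −`hZ1`, −`hpXDv`; `hLL2` assembled from its remaining displayed fields + these three (+ dag-n06-l's P-DISP 6 five) by anonymous
constructor.
HONEST FRAMING.  By-name composition of kernel-checked helper files; the G₀-layer letters `hDirR ∕ hL2M ∕ h43R` are HYPOTHESES (the certificate's derived layer);
COUNT-NEUTRAL; nothing of [B9]'s propagator estimates asserted; N06 NOT discharged; K1 NOT closed; one finite 𝕋⁴ programme at fixed `ε` — NOT continuum, NOT OS,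
NOT the mass gap ∕ Clay.  0 `def`, 0 `sorry`.
-/

noncomputable section

namespace Summit.QuantumFields.YangMills.BalabanUVNodes.N06DvLettersLegAtPinsPU

open scoped Matrix.Norms.L2Operator
open Literature.MathematicalPhysics.QuantumFieldTheory.Balaban1983to89
open Literature.MathematicalPhysics.QuantumFieldTheory.Balaban1983to89.Node00
open Literature.MathematicalPhysics.QuantumFieldTheory.Balaban1983to89.B9PinMembersKLevelV1 (MemberY geo9Y)
open Literature.MathematicalPhysics.QuantumFieldTheory.Balaban1983to89.B9BackgroundsKLevelV1R (RegFamY bg9YR MemOfFam mem_of_reg335R)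
open Literature.MathematicalPhysics.QuantumFieldTheory.Balaban1983to89.B7Prop2SpecialUnitary (specialUnitaryUnits)
open Literature.MathematicalPhysics.QuantumFieldTheory.Balaban1983to89.B6GlobalChartV1 (blkV1)
open Literature.MathematicalPhysics.QuantumFieldTheory.Balaban1983to89.B6Ineq2142KLevelV1 (β)
open Literature.MathematicalPhysics.QuantumFieldTheory.Balaban1983to89.B6Geom246MultiLevelTorus (geomT)
open Literature.MathematicalPhysics.QuantumFieldTheory.Balaban1983to89.B6RandomWalkHom (HasMajorantHom)
open Literature.MathematicalPhysics.QuantumFieldTheory.Balaban1983to89.B9CoReadingCoordsTranspose (TrIdx trBasis)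
open Literature.MathematicalPhysics.QuantumFieldTheory.Balaban1983to89.B9CoReadingCoords (coordOpK XBK blkBK cdBₗ cdsBₗ GcoK DcoK DscoK)
open Literature.MathematicalPhysics.QuantumFieldTheory.Balaban1983to89.B9CoReadingCoordsS (XSK blkSK sIK)
open Literature.MathematicalPhysics.QuantumFieldTheory.Balaban1983to89.B9CoReadingCoordsHolder (PK blkPK probeK)
open Literature.MathematicalPhysics.QuantumFieldTheory.Balaban1983to89.B9CoReadingCoordsHolderAdm (holderProbesKA wKA)
open Literature.MathematicalPhysics.QuantumFieldTheory.Balaban1983to89.B9CoReadingCoordsHolder (w₀K)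
open Literature.MathematicalPhysics.QuantumFieldTheory.Balaban1983to89.B9Thm39ReadingCoords (cR39 cR39_nonneg)
open Literature.MathematicalPhysics.QuantumFieldTheory.Balaban1983to89.B9GeoNormsKLevelV1 (geo9K geo9K_dist_nonneg)
open Literature.MathematicalPhysics.QuantumFieldTheory.Balaban1983to89.B9GeoLemma21KLevelV1 (geo9Y_dist_triangle geo9Y_dist_comm geo9Y_len_pos rowSum261_geo9Y)
open Literature.MathematicalPhysics.QuantumFieldTheory.Balaban1983to89.B9Thm34Ext (toB6)
open Literature.MathematicalPhysics.QuantumFieldTheory.Balaban1983to89.B9SectDL2Decay (BlockBd)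
open Literature.MathematicalPhysics.QuantumFieldTheory.Balaban1983to89.B11SectG (HasMaj BlockNorm RowSum)
open Literature.MathematicalPhysics.QuantumFieldTheory.Balaban1983to89.B9Thm312Whole (Ops GeoOK cNorm)
open Literature.MathematicalPhysics.QuantumFieldTheory.Balaban1983to89.B9Thm312WholeClasses (cNormR)
open Literature.MathematicalPhysics.QuantumFieldTheory.Balaban1983to89.B9Thm312WholeDir (Thm33G0L2M)
open Literature.MathematicalPhysics.QuantumFieldTheory.Balaban1983to89.B9Thm313WholeDir (Thm33G0DirR)
open Literature.MathematicalPhysics.QuantumFieldTheory.Balaban1983to89.B9RWSums343Holder (HolderProbes)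
open Literature.MathematicalPhysics.QuantumFieldTheory.Balaban1983to89.B9RWSums343to347Whole (Facts347)
open Literature.MathematicalPhysics.QuantumFieldTheory.Balaban1983to89.B9RWSums347DefiniteFaces (exp261 facts347_exp261_geo9Y)
open Literature.MathematicalPhysics.QuantumFieldTheory.Balaban1983to89.B9GradViaDivLettersAtPins (rJ)
open Literature.MathematicalPhysics.QuantumFieldTheory.Balaban1983to89.Node00.OpsYSectDCoords (DvcoKH)
open Literature.MathematicalPhysics.QuantumFieldTheory.Balaban1983to89.B9Thm313WholeDvAtPinsR (gD2_pinsB gDv_pinsB dGDvd_pinsB dGDv_pinsB pXDv_pinsB)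

variable {N : ℕ}

/-- ★★★ **THE D_U-RIGHT LETTERS OF ROWS 20–21 AT THE PINS, MEMBER-UNIFORMLY, FROM THE G₀ LAYER** (module docstring): from the directional right entries
`hDirR` (G₀∇\*_{U,μ}, sup) and `hL2M` (block L²) of the DERIVED Theorem 3.3 for G₀ and its bundled (3.43)₂ probe member `h43R` at (B12₀ ∕ B12₂ ∕ Bh12, δ12₀), the
1-faithful block map `hβ1`, def-Y's Sect.-D pins `hblk12 hblkW12 hblkY12 hG0co12 hDco12 hDsco12 hDvco12`, the direction pins `hDd ∕ hDds`, the probe pin `h𝔭A`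
(cut carrier, any transporter `parB`), the class axiom `hGR`, and the STRICT budget `δ12₃ < δ12₀`, ONE `obtain` gives `MD ≥ M12`, `BZ ≥ 0`, `BX ≥ 0`, `BL ≥ 0` and,
above `MD` in the layer's regime, the certificate's `hZ1` at `(BZ, δ12₃)`, `hpXDv` at `(BX β, δ12₃)` (all `0 ≤ β < 1`) and `hLL2`'s `gDv ∕ dGDv ∕ dGDvd ν` at
`(BL, δ12₃)`.  Inside: `Facts347` at `α := ½`, `δ_F := 2(δ12₀ − δ12₃)` (`facts347_exp261_geo9Y`), row sum at rate 1 (`rowSum261_geo9Y`), the carrier-generic member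
packages `gD2_pinsB ∕ pXDv_pinsB ∕ gDv_pinsB ∕ dGDv_pinsB ∕ dGDvd_pinsB` (`B9Thm313WholeDvAtPinsR`, twins of dag-n06-l g17's).
[cite: Balaban1985BackgroundPropagators, Thm 3.12 pp.421–423, Thm 3.13 p.426, (3.133) p.422, (3.152)–(3.153) p.426, (3.42)–(3.43)+(3.46) pp.397–398, p.398 (remark after (3.47)), (3.3) p.390, (3.8) p.392, (3.35) p.396; Balaban1984PropagatorsII, (2.51)–(2.56) pp.232–233, Lemma 2.1 (2.59)–(2.61) pp.233–234] -/
theorem dv_letters_of_pins (θ : Stage3Params) (Mstar : ℕ) {R₁ R₂ : RegFamY θ.d₆ θ.ℓ₆ θ.hd' θ.hL' θ.b₀ θ.b₁ Mstar (Matrix (Fin N) (Fin N) ℂ)} {c : ℝ}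
    (hGR : MemOfFam (specialUnitaryUnits (Fin N)) R₁)
    [∀ x : MemberY θ.d₆ θ.ℓ₆ θ.hd' θ.hL' θ.b₀ θ.b₁ Mstar, Fintype (geo9Y x).Site]
    (bI : ∀ x : MemberY θ.d₆ θ.ℓ₆ θ.hd' θ.hL' θ.b₀ θ.b₁ Mstar, FBondY x.toKIdx → IBondY x.toKIdx)
    (hβ1 : ∀ (x : MemberY θ.d₆ θ.ℓ₆ θ.hd' θ.hL' θ.b₀ θ.b₁ Mstar) (f : FBondY x.toKIdx), (geomT x.D).dist (β x.hN x.D x.hk (bI x f)) (blkV1 x.hN x.D f) ≤ 1)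
    (H12 : MemberY θ.d₆ θ.ℓ₆ θ.hd' θ.hL' θ.b₀ θ.b₁ Mstar → Prop) {Z12 : MemberY θ.d₆ θ.ℓ₆ θ.hd' θ.hL' θ.b₀ θ.b₁ Mstar → Type} [∀ x, Fintype (Z12 x)]
    (𝔬12 : ∀ x : MemberY θ.d₆ θ.ℓ₆ θ.hd' θ.hL' θ.b₀ θ.b₁ Mstar, B9Thm312Whole.Ops (geo9Y x) (bg9YR (Matrix (Fin N) (Fin N) ℂ) (specialUnitaryUnits (Fin N)) R₁ R₂ x) (XBK (TrIdx N) x.toKIdx) (XBK (TrIdx N) x.toKIdx) (Z12 x) (XSK (TrIdx N) x.toKIdx))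
    (𝔭A : ∀ x : MemberY θ.d₆ θ.ℓ₆ θ.hd' θ.hL' θ.b₀ θ.b₁ Mstar, HolderProbes (geo9Y x) (bg9YR (Matrix (Fin N) (Fin N) ℂ) (specialUnitaryUnits (Fin N)) R₁ R₂ x) (XBK (TrIdx N) x.toKIdx) (XBK (TrIdx N) x.toKIdx) (PK (FBondY x.toKIdx) (Fin (θ.d₆ + 1)) (TrIdx N)) (PK (FBondY x.toKIdx) (Fin (θ.d₆ + 1)) (TrIdx N)))
    (parB : ∀ x : MemberY θ.d₆ θ.ℓ₆ θ.hd' θ.hL' θ.b₀ θ.b₁ Mstar, BondParY (Matrix (Fin N) (Fin N) ℂ) x.toKIdx)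
    (h𝔭A : ∀ x : MemberY θ.d₆ θ.ℓ₆ θ.hd' θ.hL' θ.b₀ θ.b₁ Mstar, 𝔭A x = holderProbesKA x.toKIdx (trBasis N) (bg9YR (Matrix (Fin N) (Fin N) ℂ) (specialUnitaryUnits (Fin N)) R₁ R₂ x) (fun U => U) (parB x) (bI x))
    (O : ∀ x : MemberY θ.d₆ θ.ℓ₆ θ.hd' θ.hL' θ.b₀ θ.b₁ Mstar, BondOpY (Matrix (Fin N) (Fin N) ℂ) x.toKIdx)
    (Dd Dds : ∀ x : MemberY θ.d₆ θ.ℓ₆ θ.hd' θ.hL' θ.b₀ θ.b₁ Mstar, (bg9YR (Matrix (Fin N) (Fin N) ℂ) (specialUnitaryUnits (Fin N)) R₁ R₂ x).Cfg → Fin (θ.d₆ + 1) → Module.End ℝ (XBK (TrIdx N) x.toKIdx → ℝ))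
    (hDd : ∀ (x : MemberY θ.d₆ θ.ℓ₆ θ.hd' θ.hL' θ.b₀ θ.b₁ Mstar) (U : (bg9YR (Matrix (Fin N) (Fin N) ℂ) (specialUnitaryUnits (Fin N)) R₁ R₂ x).Cfg), Dd x U = fun ν => coordOpK (trBasis N) (fun _ : Fin (θ.d₆ + 1) => cdBₗ x.toKIdx U ν))
    (hDds : ∀ (x : MemberY θ.d₆ θ.ℓ₆ θ.hd' θ.hL' θ.b₀ θ.b₁ Mstar) (U : (bg9YR (Matrix (Fin N) (Fin N) ℂ) (specialUnitaryUnits (Fin N)) R₁ R₂ x).Cfg), Dds x U = fun μ => coordOpK (trBasis N) (fun _ : Fin (θ.d₆ + 1) => cdsBₗ x.toKIdx U μ))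
    (hblk12 : ∀ x : MemberY θ.d₆ θ.ℓ₆ θ.hd' θ.hL' θ.b₀ θ.b₁ Mstar, (𝔬12 x).blk = blkBK x.toKIdx (bI x))
    (hblkW12 : ∀ x : MemberY θ.d₆ θ.ℓ₆ θ.hd' θ.hL' θ.b₀ θ.b₁ Mstar, (𝔬12 x).blkW = blkSK x.toKIdx (sIK x.toKIdx (bI x)))
    (hblkY12 : ∀ x : MemberY θ.d₆ θ.ℓ₆ θ.hd' θ.hL' θ.b₀ θ.b₁ Mstar, (𝔬12 x).blkY = blkBK x.toKIdx (bI x))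
    (hG0co12 : ∀ (x : MemberY θ.d₆ θ.ℓ₆ θ.hd' θ.hL' θ.b₀ θ.b₁ Mstar) (U : (bg9YR (Matrix (Fin N) (Fin N) ℂ) (specialUnitaryUnits (Fin N)) R₁ R₂ x).Cfg), (𝔬12 x).G0 U = GcoK x.toKIdx (trBasis N) (bg9YR (Matrix (Fin N) (Fin N) ℂ) (specialUnitaryUnits (Fin N)) R₁ R₂ x) (fun U => U) (O x) U)
    (hDco12 : ∀ (x : MemberY θ.d₆ θ.ℓ₆ θ.hd' θ.hL' θ.b₀ θ.b₁ Mstar) (U : (bg9YR (Matrix (Fin N) (Fin N) ℂ) (specialUnitaryUnits (Fin N)) R₁ R₂ x).Cfg), (𝔬12 x).D U = DcoK x.toKIdx (trBasis N) (bg9YR (Matrix (Fin N) (Fin N) ℂ) (specialUnitaryUnits (Fin N)) R₁ R₂ x) (fun U => U) U)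
    (hDsco12 : ∀ (x : MemberY θ.d₆ θ.ℓ₆ θ.hd' θ.hL' θ.b₀ θ.b₁ Mstar) (U : (bg9YR (Matrix (Fin N) (Fin N) ℂ) (specialUnitaryUnits (Fin N)) R₁ R₂ x).Cfg), (𝔬12 x).Dstar U = DscoK x.toKIdx (trBasis N) (bg9YR (Matrix (Fin N) (Fin N) ℂ) (specialUnitaryUnits (Fin N)) R₁ R₂ x) (fun U => U) U)
    (hDvco12 : ∀ (x : MemberY θ.d₆ θ.ℓ₆ θ.hd' θ.hL' θ.b₀ θ.b₁ Mstar) (U : (bg9YR (Matrix (Fin N) (Fin N) ℂ) (specialUnitaryUnits (Fin N)) R₁ R₂ x).Cfg), (𝔬12 x).Dv U = DvcoKH x.toKIdx (trBasis N) (bg9YR (Matrix (Fin N) (Fin N) ℂ) (specialUnitaryUnits (Fin N)) R₁ R₂ x) (fun U => U) U)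
    {M12 a12 B12₀ B12₂ δ12₀ δ12₃ : ℝ} {Bh12 : ℝ → ℝ} (hB12₀ : 0 ≤ B12₀) (hB12₂ : 0 ≤ B12₂) (hBh12 : ∀ β', 0 ≤ β' → β' < 1 → 0 ≤ Bh12 β')
    (hδ30 : 0 ≤ δ12₃) (hδ₃₀ : δ12₃ < δ12₀)
    (hDirR : ∀ x : MemberY θ.d₆ θ.ℓ₆ θ.hd' θ.hL' θ.b₀ θ.b₁ Mstar, M12 ≤ (geo9Y x).M → ∀ α₀ : ℝ, 0 < α₀ → (geo9Y x).M * α₀ ≤ a12 → ∀ U : (bg9YR (Matrix (Fin N) (Fin N) ℂ) (specialUnitaryUnits (Fin N)) R₁ R₂ x).Cfg, (bg9YR (Matrix (Fin N) (Fin N) ℂ) (specialUnitaryUnits (Fin N)) R₁ R₂ x).Reg335 c α₀ U →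
      (bg9YR (Matrix (Fin N) (Fin N) ℂ) (specialUnitaryUnits (Fin N)) R₁ R₂ x).Reg336 c α₀ U → Thm33G0DirR (𝔬12 x) (Dds x) 1 (H12 x) B12₀ δ12₀ U)
    (hL2M : ∀ x : MemberY θ.d₆ θ.ℓ₆ θ.hd' θ.hL' θ.b₀ θ.b₁ Mstar, M12 ≤ (geo9Y x).M → ∀ α₀ : ℝ, 0 < α₀ → (geo9Y x).M * α₀ ≤ a12 → ∀ U : (bg9YR (Matrix (Fin N) (Fin N) ℂ) (specialUnitaryUnits (Fin N)) R₁ R₂ x).Cfg, (bg9YR (Matrix (Fin N) (Fin N) ℂ) (specialUnitaryUnits (Fin N)) R₁ R₂ x).Reg335 c α₀ U →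
      (bg9YR (Matrix (Fin N) (Fin N) ℂ) (specialUnitaryUnits (Fin N)) R₁ R₂ x).Reg336 c α₀ U → Thm33G0L2M (𝔬12 x) (Dd x) (Dds x) 1 (H12 x) B12₂ δ12₀ U)
    (h43R : ∀ x : MemberY θ.d₆ θ.ℓ₆ θ.hd' θ.hL' θ.b₀ θ.b₁ Mstar, M12 ≤ (geo9Y x).M → ∀ α₀ : ℝ, 0 < α₀ → (geo9Y x).M * α₀ ≤ a12 → ∀ U : (bg9YR (Matrix (Fin N) (Fin N) ℂ) (specialUnitaryUnits (Fin N)) R₁ R₂ x).Cfg, (bg9YR (Matrix (Fin N) (Fin N) ℂ) (specialUnitaryUnits (Fin N)) R₁ R₂ x).Reg335 c α₀ U →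
      (bg9YR (Matrix (Fin N) (Fin N) ℂ) (specialUnitaryUnits (Fin N)) R₁ R₂ x).Reg336 c α₀ U → ∀ β' : ℝ, 0 ≤ β' → β' < 1 →
        HasMajorantHom (g := toB6 (geo9Y x) 1 (H12 x)) (𝔬12 x).blkY (𝔭A x).blkPX ((𝔭A x).ΦX U β' ∘ₗ ((𝔬12 x).G0 U ∘ₗ (𝔬12 x).Dstar U))
          (fun (a b : (geo9Y x).Site) => Bh12 β' * (geo9Y x).len a ^ (1 - β') * Real.exp (-(δ12₀ * (geo9Y x).dist a b)))) :
    ∃ (MD BZ : ℝ) (BX : ℝ → ℝ) (BL : ℝ), M12 ≤ MD ∧ 0 ≤ BZ ∧ (∀ β', 0 ≤ β' → β' < 1 → 0 ≤ BX β') ∧ 0 ≤ BL ∧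
      ∀ x : MemberY θ.d₆ θ.ℓ₆ θ.hd' θ.hL' θ.b₀ θ.b₁ Mstar, MD ≤ (geo9Y x).M → ∀ α₀ : ℝ, 0 < α₀ → (geo9Y x).M * α₀ ≤ a12 → ∀ U : (bg9YR (Matrix (Fin N) (Fin N) ℂ) (specialUnitaryUnits (Fin N)) R₁ R₂ x).Cfg, (bg9YR (Matrix (Fin N) (Fin N) ℂ) (specialUnitaryUnits (Fin N)) R₁ R₂ x).Reg335 c α₀ U → (bg9YR (Matrix (Fin N) (Fin N) ℂ) (specialUnitaryUnits (Fin N)) R₁ R₂ x).Reg336 c α₀ U →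
        -- `hZ1`: G₀D_U : 𝔠_W⁽¹⁾ → 𝔠⁽²⁾
        HasMaj (cNorm 1 (H12 x) (𝔬12 x).blkW (fun y => (geo9Y_len_pos x y).le) 1) (cNorm 1 (H12 x) (𝔬12 x).blk (fun y => (geo9Y_len_pos x y).le) 2)
          ((𝔬12 x).G0 U ∘ₗ (𝔬12 x).Dv U) (fun a b => BZ * Real.exp (-(δ12₃ * (geo9Y x).dist a b))) ∧
        -- `hpXDv`: Φ^X_β∘G₀∘D_U : 𝔠_W⁽⁰⁾ → 𝔠_P^{(β−1)}
        (∀ β' : ℝ, 0 ≤ β' → β' < 1 →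
          HasMaj (cNormR 1 (H12 x) (𝔬12 x).blkW (fun y => (geo9Y_len_pos x y).le) 0) (cNormR 1 (H12 x) (𝔭A x).blkPX (fun y => (geo9Y_len_pos x y).le) (β' - 1))
            (((𝔭A x).ΦX U β' ∘ₗ (𝔬12 x).G0 U) ∘ₗ (𝔬12 x).Dv U) (fun a b => BX β' * Real.exp (-(δ12₃ * (geo9Y x).dist a b)))) ∧
        -- `hLL2`.1.gDv: G₀D_U in block L²
        BlockBd (g := toB6 (geo9Y x) 1 (H12 x)) (𝔬12 x).blkW (𝔬12 x).blk ((𝔬12 x).G0 U ∘ₗ (𝔬12 x).Dv U)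
          (fun (y y' : (geo9Y x).Site) => BL * (geo9Y x).len y * Real.exp (-(δ12₃ * (geo9Y x).dist y y'))) ∧
        -- `hLL2`.1.dGDv: ∇_UG₀D_U in block L²
        BlockBd (g := toB6 (geo9Y x) 1 (H12 x)) (𝔬12 x).blkW (𝔬12 x).blkY ((𝔬12 x).D U ∘ₗ (𝔬12 x).G0 U ∘ₗ (𝔬12 x).Dv U)
          (fun (y y' : (geo9Y x).Site) => BL * Real.exp (-(δ12₃ * (geo9Y x).dist y y'))) ∧
        -- `hLL2`.2.dGDvd ν: ∇_{U,ν}G₀D_U in block L²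
        (∀ ν : Fin (θ.d₆ + 1), BlockBd (g := toB6 (geo9Y x) 1 (H12 x)) (𝔬12 x).blkW (𝔬12 x).blk (Dd x U ν ∘ₗ (𝔬12 x).G0 U ∘ₗ (𝔬12 x).Dv U)
          (fun (y y' : (geo9Y x).Site) => BL * Real.exp (-(δ12₃ * (geo9Y x).dist y y')))) := by
  -- the strict budget is the [4] (2.60) transfer gap: α := 1/2, δ_F := 2(δ12₀ − δ12₃) > 0, so that δ12₀ − α·δ_F = δ12₃
  have hδF : 0 < 2 * (δ12₀ - δ12₃) := by linarith
  obtain ⟨Mg, hFa⟩ := facts347_exp261_geo9Y (d := θ.d₆) (ℓ := θ.ℓ₆) (hd := θ.hd') (hL := θ.hL') (b₀ := θ.b₀) (b₁ := θ.b₁) (Mstar := Mstar) H12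
    (α := 1 / 2) (by norm_num) (by norm_num) hδF
  -- a [4] (2.61) row sum at rate 1 (only its constant enters)
  obtain ⟨ML, cL, hrowL⟩ := rowSum261_geo9Y (d := θ.d₆) (ℓ := θ.ℓ₆) (hd := θ.hd') (hL := θ.hL') (b₀ := θ.b₀) (b₁ := θ.b₁) (Mstar := Mstar) 1 one_pos
  have hrow : ∀ x : MemberY θ.d₆ θ.ℓ₆ θ.hd' θ.hL' θ.b₀ θ.b₁ Mstar, ML ≤ (geo9Y x).M → RowSum (toB6 (geo9Y x) 1 (H12 x)) 1 (max cL 0) :=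
    fun x hM y => (hrowL x hM y).trans (le_max_left _ _)
  -- the produced constants: C_J = cR39·e^{(δ12₀+1)·rJ} (the kinematic letter at rate δ_J := δ12₀ + 1), c := max cL 0, L₀ := ℓ+1
  set CJ : ℝ := cR39 (trBasis N) * Real.exp ((δ12₀ + 1) * rJ θ.d₆ θ.ℓ₆) with hCJ
  have hCJ0 : 0 ≤ CJ := mul_nonneg (cR39_nonneg _) (Real.exp_nonneg _)
  have hc0 : 0 ≤ max cL 0 := le_max_right _ _
  set BZ : ℝ := ((θ.d₆ : ℝ) + 1) * (B12₀ * CJ * max cL 0) * ((θ.ℓ₆ + 1 : ℕ) : ℝ) with hBZ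
  set BX : ℝ → ℝ := fun β' => ((θ.d₆ : ℝ) + 1) * (Bh12 β' * CJ * max cL 0) with hBX
  set BL : ℝ := ((θ.d₆ : ℝ) + 1) * (B12₂ * CJ * max cL 0) + ((θ.d₆ : ℝ) + 1) ^ 2 * (1 * (B12₂ * CJ * max cL 0) * max cL 0) with hBL
  have hd0 : 0 ≤ (θ.d₆ : ℝ) + 1 := by positivity
  have hBZ0 : 0 ≤ BZ := by rw [hBZ]; exact mul_nonneg (mul_nonneg hd0 (mul_nonneg (mul_nonneg hB12₀ hCJ0) hc0)) (Nat.cast_nonneg _)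
  have hBX0 : ∀ β', 0 ≤ β' → β' < 1 → 0 ≤ BX β' := fun β' h0 h1 => by
    simp only [hBX]; exact mul_nonneg hd0 (mul_nonneg (mul_nonneg (hBh12 β' h0 h1) hCJ0) hc0)
  have hBLa : 0 ≤ ((θ.d₆ : ℝ) + 1) * (B12₂ * CJ * max cL 0) := mul_nonneg hd0 (mul_nonneg (mul_nonneg hB12₂ hCJ0) hc0)
  have hBLb : 0 ≤ ((θ.d₆ : ℝ) + 1) ^ 2 * (1 * (B12₂ * CJ * max cL 0) * max cL 0) :=
    mul_nonneg (pow_nonneg hd0 2) (mul_nonneg (mul_nonneg zero_le_one (mul_nonneg (mul_nonneg hB12₂ hCJ0) hc0)) hc0)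
  have hBL0 : 0 ≤ BL := by rw [hBL]; exact add_nonneg hBLa hBLb
  have hδ00 : 0 ≤ δ12₀ := hδ30.trans hδ₃₀.le
  have hδJ : (0 : ℝ) ≤ δ12₀ + 1 := by linarith
  have hδ₃' : δ12₃ ≤ δ12₀ - 1 / 2 * (2 * (δ12₀ - δ12₃)) := by linarith
  have hδ₃J : δ12₃ + 1 ≤ δ12₀ + 1 := by linarith
  refine ⟨max M12 (max ML Mg), BZ, BX, BL, le_max_left _ _, hBZ0, hBX0, hBL0, fun x hM α₀ hα ha U hU hU' => ?_⟩
  letI : Fintype (geo9K x.toKIdx).Site := (inferInstance : Fintype (geo9Y x).Site)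
  have hM12x : M12 ≤ (geo9Y x).M := (le_max_left _ _).trans hM
  have hMLx : ML ≤ (geo9Y x).M := ((le_max_left _ _).trans (le_max_right _ _)).trans hM
  have hMgx : Mg ≤ (geo9Y x).M := ((le_max_right _ _).trans (le_max_right _ _)).trans hM
  have hUG : ∀ μ z, (fun U : (bg9YR (Matrix (Fin N) (Fin N) ℂ) (specialUnitaryUnits (Fin N)) R₁ R₂ x).Cfg => U) U μ z ∈ specialUnitaryUnits (Fin N) :=
    fun μ z => mem_of_reg335R hGR x hU μ z
  have hFax := hFa x hMgx
  have hrowx := hrow x hMLx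
  have hG : GeoOK (geo9Y x) := ⟨geo9Y_dist_triangle x, geo9Y_dist_comm x, geo9K_dist_nonneg x.toKIdx, geo9Y_len_pos x⟩
  have hDirRx := hDirR x hM12x α₀ hα ha U hU hU'
  have hL2Mx := hL2M x hM12x α₀ hα ha U hU hU'
  -- the probe pins of the cut carrier
  have hΦX : ∀ β' : ℝ, (𝔭A x).ΦX U β' = probeK (trBasis N) (fun b b' : FBondY x.toKIdx => parB x U b.src b'.src)
      ((fun β' => wKA x.toKIdx β') β') ((fun β' => w₀K x.toKIdx β') β') := fun β' => by rw [h𝔭A x]; rfl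
  have hPX : (𝔭A x).blkPX = blkPK (bI x) := by rw [h𝔭A x]; rfl
  refine ⟨?_, ?_, ?_, ?_, ?_⟩
  · -- `hZ1` = `gD2` (the one-power transfer of p. 398 at α := 1/2, δ_F := 2(δ12₀ − δ12₃))
    exact gD2_pinsB x (hβ1 x) (B := bg9YR (Matrix (Fin N) (Fin N) ℂ) (specialUnitaryUnits (Fin N)) R₁ R₂ x) (cfg := fun U => U) (U := U) hUG hG hrowx hFax
      (𝔬12 x) (hblk12 x) (hblkW12 x) (hDvco12 x U) (hDds x U) (B₀ := B12₀) (δ₀ := δ12₀) (δJ := δ12₀ + 1) (δ₃ := δ12₀) (B₃' := BZ) (δ₃' := δ12₃)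
      hB12₀ hc0 hδJ hδ00 le_rfl le_rfl (le_of_eq (by rw [hBZ])) hδ₃' (fun μ => hDirRx.e2d μ)
  · -- `hpXDv`
    intro β' h0 h1
    exact pXDv_pinsB x (hβ1 x) (B := bg9YR (Matrix (Fin N) (Fin N) ℂ) (specialUnitaryUnits (Fin N)) R₁ R₂ x) (cfg := fun U => U) (U := U) hUG hG hrowx
      (𝔬12 x) (𝔭A x) (O x) (bP := bI x) (fun b b' : FBondY x.toKIdx => parB x U b.src b'.src) (fun β' => wKA x.toKIdx β') (fun β' => w₀K x.toKIdx β')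
      (hblk12 x) (hblkY12 x) (hblkW12 x) (hG0co12 x U) (hDsco12 x U) (hDvco12 x U) (hDds x U) (hΦX β') hPX
      (Bh := Bh12 β') (δ₀ := δ12₀) (δJ := δ12₀ + 1) (Bx := BX β') (δ₃ := δ12₃) (hBh12 β' h0 h1) hδJ hδ30 hδ₃₀.le hδ₃J (le_of_eq (by rw [hBX, hCJ]))
      (h43R x hM12x α₀ hα ha U hU hU' β' h0 h1)
  · -- `gDv`
    exact gDv_pinsB x (hβ1 x) (B := bg9YR (Matrix (Fin N) (Fin N) ℂ) (specialUnitaryUnits (Fin N)) R₁ R₂ x) (cfg := fun U => U) (U := U) hUG hG hrowx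
      (𝔬12 x) (hblk12 x) (hblkW12 x) (hDvco12 x U) (hDds x U) (B₂ := B12₂) (δ₁ := δ12₀) (δJ := δ12₀ + 1) (B₄ := BL) (ρ := δ12₃)
      hB12₂ hδJ hδ30 hδ₃₀.le hδ₃J (by rw [hBL]; exact le_add_of_nonneg_right hBLb) (fun μ => hL2Mx.l2d μ)
  · -- `dGDv`
    exact dGDv_pinsB x (hβ1 x) (B := bg9YR (Matrix (Fin N) (Fin N) ℂ) (specialUnitaryUnits (Fin N)) R₁ R₂ x) (cfg := fun U => U) (U := U) hUG hG hrowx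
      (𝔬12 x) (hblk12 x) (hblkY12 x) (hblkW12 x) (hDvco12 x U) (hDco12 x U) (hDd x U) (hDds x U) (B₂ := B12₂) (δ₁ := δ12₀) (δJ := δ12₀ + 1) (B₄ := BL)
      (ρ := δ12₃) hB12₂ hc0 hδJ hδ30 hδ₃₀.le hδ₃J (by rw [hBL]; exact le_add_of_nonneg_left hBLa) (fun ν μ => hL2Mx.l4m (ν, μ))
  · -- `dGDvd ν`
    intro ν
    exact dGDvd_pinsB x (hβ1 x) (B := bg9YR (Matrix (Fin N) (Fin N) ℂ) (specialUnitaryUnits (Fin N)) R₁ R₂ x) (cfg := fun U => U) (U := U) hUG hG hrowx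
      (𝔬12 x) (hblk12 x) (hblkW12 x) (hDvco12 x U) (Dd := Dd x U) (hDds x U) (B₂ := B12₂) (δ₁ := δ12₀) (δJ := δ12₀ + 1) (B₄ := BL) (ρ := δ12₃)
      hB12₂ hδJ hδ30 hδ₃₀.le hδ₃J (by rw [hBL]; exact le_add_of_nonneg_right hBLb) ν (fun μ => hL2Mx.l4m (ν, μ))

/-- ★★ **THE `hpXDv` FAMILY WITH AN EXPLICIT β-PROFILE** (v1.1 handle asked by dag-n06-d, ED.97 «UX»: the certificate's U8 state layer carries the SUP bound
`hwBx13 : wX s · Bx13 s ≤ Bx13₀`, so folding `hpXDv` needs the produced profile to be LINEAR in the displayed `Bh12`): ∃ `MD ≥ M12` and ONE constant `KX ≥ 0`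
(= (d+1)·C_J·c, C_J = c_R·e^{(δ12₀+1)·rJ}, c the [4] (2.61) row-sum constant at rate 1) such that above `MD`, in the layer's regime, for every `0 ≤ β′ < 1`:
Φ^X_{β′}∘G₀∘D_U : 𝔠_W⁽⁰⁾ → 𝔠_P^{(β′−1)} has the majorant `(KX·Bh12 β′)·e^{−δ12₃d}` — `dv_letters_of_pins`'s second conjunct with `BX β′ := KX·Bh12 β′` made visible
(same inputs minus the G₀ sup∕L² layers and `B12₀ ∕ B12₂`; only `δ12₃ ≤ δ12₀` is used).  Knit: `Bx13₀ := max Bx13₀ (KX·BHG)` with the displayed `hwBhG`.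
[cite: Balaban1985BackgroundPropagators, Thm 3.12 (3.43)–(3.44) pp.397–398 + pp.421–423, (3.133) p.422, (3.3) p.390, (3.8) p.392, (3.35) p.396; Balaban1984PropagatorsII, (2.51)–(2.56) pp.232–233, Lemma 2.1 (2.61) p.234] -/
theorem pXDv_of_pins_KX (θ : Stage3Params) (Mstar : ℕ) {R₁ R₂ : RegFamY θ.d₆ θ.ℓ₆ θ.hd' θ.hL' θ.b₀ θ.b₁ Mstar (Matrix (Fin N) (Fin N) ℂ)} {c : ℝ}
    (hGR : MemOfFam (specialUnitaryUnits (Fin N)) R₁)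
    [∀ x : MemberY θ.d₆ θ.ℓ₆ θ.hd' θ.hL' θ.b₀ θ.b₁ Mstar, Fintype (geo9Y x).Site]
    (bI : ∀ x : MemberY θ.d₆ θ.ℓ₆ θ.hd' θ.hL' θ.b₀ θ.b₁ Mstar, FBondY x.toKIdx → IBondY x.toKIdx)
    (hβ1 : ∀ (x : MemberY θ.d₆ θ.ℓ₆ θ.hd' θ.hL' θ.b₀ θ.b₁ Mstar) (f : FBondY x.toKIdx), (geomT x.D).dist (β x.hN x.D x.hk (bI x f)) (blkV1 x.hN x.D f) ≤ 1)
    (H12 : MemberY θ.d₆ θ.ℓ₆ θ.hd' θ.hL' θ.b₀ θ.b₁ Mstar → Prop) {Z12 : MemberY θ.d₆ θ.ℓ₆ θ.hd' θ.hL' θ.b₀ θ.b₁ Mstar → Type} [∀ x, Fintype (Z12 x)]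
    (𝔬12 : ∀ x : MemberY θ.d₆ θ.ℓ₆ θ.hd' θ.hL' θ.b₀ θ.b₁ Mstar, B9Thm312Whole.Ops (geo9Y x) (bg9YR (Matrix (Fin N) (Fin N) ℂ) (specialUnitaryUnits (Fin N)) R₁ R₂ x) (XBK (TrIdx N) x.toKIdx) (XBK (TrIdx N) x.toKIdx) (Z12 x) (XSK (TrIdx N) x.toKIdx))
    (𝔭A : ∀ x : MemberY θ.d₆ θ.ℓ₆ θ.hd' θ.hL' θ.b₀ θ.b₁ Mstar, HolderProbes (geo9Y x) (bg9YR (Matrix (Fin N) (Fin N) ℂ) (specialUnitaryUnits (Fin N)) R₁ R₂ x) (XBK (TrIdx N) x.toKIdx) (XBK (TrIdx N) x.toKIdx) (PK (FBondY x.toKIdx) (Fin (θ.d₆ + 1)) (TrIdx N)) (PK (FBondY x.toKIdx) (Fin (θ.d₆ + 1)) (TrIdx N)))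
    (parB : ∀ x : MemberY θ.d₆ θ.ℓ₆ θ.hd' θ.hL' θ.b₀ θ.b₁ Mstar, BondParY (Matrix (Fin N) (Fin N) ℂ) x.toKIdx)
    (h𝔭A : ∀ x : MemberY θ.d₆ θ.ℓ₆ θ.hd' θ.hL' θ.b₀ θ.b₁ Mstar, 𝔭A x = holderProbesKA x.toKIdx (trBasis N) (bg9YR (Matrix (Fin N) (Fin N) ℂ) (specialUnitaryUnits (Fin N)) R₁ R₂ x) (fun U => U) (parB x) (bI x))
    (O : ∀ x : MemberY θ.d₆ θ.ℓ₆ θ.hd' θ.hL' θ.b₀ θ.b₁ Mstar, BondOpY (Matrix (Fin N) (Fin N) ℂ) x.toKIdx)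
    (Dds : ∀ x : MemberY θ.d₆ θ.ℓ₆ θ.hd' θ.hL' θ.b₀ θ.b₁ Mstar, (bg9YR (Matrix (Fin N) (Fin N) ℂ) (specialUnitaryUnits (Fin N)) R₁ R₂ x).Cfg → Fin (θ.d₆ + 1) → Module.End ℝ (XBK (TrIdx N) x.toKIdx → ℝ))
    (hDds : ∀ (x : MemberY θ.d₆ θ.ℓ₆ θ.hd' θ.hL' θ.b₀ θ.b₁ Mstar) (U : (bg9YR (Matrix (Fin N) (Fin N) ℂ) (specialUnitaryUnits (Fin N)) R₁ R₂ x).Cfg), Dds x U = fun μ => coordOpK (trBasis N) (fun _ : Fin (θ.d₆ + 1) => cdsBₗ x.toKIdx U μ))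
    (hblk12 : ∀ x : MemberY θ.d₆ θ.ℓ₆ θ.hd' θ.hL' θ.b₀ θ.b₁ Mstar, (𝔬12 x).blk = blkBK x.toKIdx (bI x))
    (hblkW12 : ∀ x : MemberY θ.d₆ θ.ℓ₆ θ.hd' θ.hL' θ.b₀ θ.b₁ Mstar, (𝔬12 x).blkW = blkSK x.toKIdx (sIK x.toKIdx (bI x)))
    (hblkY12 : ∀ x : MemberY θ.d₆ θ.ℓ₆ θ.hd' θ.hL' θ.b₀ θ.b₁ Mstar, (𝔬12 x).blkY = blkBK x.toKIdx (bI x))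
    (hG0co12 : ∀ (x : MemberY θ.d₆ θ.ℓ₆ θ.hd' θ.hL' θ.b₀ θ.b₁ Mstar) (U : (bg9YR (Matrix (Fin N) (Fin N) ℂ) (specialUnitaryUnits (Fin N)) R₁ R₂ x).Cfg), (𝔬12 x).G0 U = GcoK x.toKIdx (trBasis N) (bg9YR (Matrix (Fin N) (Fin N) ℂ) (specialUnitaryUnits (Fin N)) R₁ R₂ x) (fun U => U) (O x) U)
    (hDsco12 : ∀ (x : MemberY θ.d₆ θ.ℓ₆ θ.hd' θ.hL' θ.b₀ θ.b₁ Mstar) (U : (bg9YR (Matrix (Fin N) (Fin N) ℂ) (specialUnitaryUnits (Fin N)) R₁ R₂ x).Cfg), (𝔬12 x).Dstar U = DscoK x.toKIdx (trBasis N) (bg9YR (Matrix (Fin N) (Fin N) ℂ) (specialUnitaryUnits (Fin N)) R₁ R₂ x) (fun U => U) U)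
    (hDvco12 : ∀ (x : MemberY θ.d₆ θ.ℓ₆ θ.hd' θ.hL' θ.b₀ θ.b₁ Mstar) (U : (bg9YR (Matrix (Fin N) (Fin N) ℂ) (specialUnitaryUnits (Fin N)) R₁ R₂ x).Cfg), (𝔬12 x).Dv U = DvcoKH x.toKIdx (trBasis N) (bg9YR (Matrix (Fin N) (Fin N) ℂ) (specialUnitaryUnits (Fin N)) R₁ R₂ x) (fun U => U) U)
    {M12 a12 δ12₀ δ12₃ : ℝ} {Bh12 : ℝ → ℝ} (hBh12 : ∀ β', 0 ≤ β' → β' < 1 → 0 ≤ Bh12 β') (hδ30 : 0 ≤ δ12₃) (hδ₃₀ : δ12₃ ≤ δ12₀)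
    (h43R : ∀ x : MemberY θ.d₆ θ.ℓ₆ θ.hd' θ.hL' θ.b₀ θ.b₁ Mstar, M12 ≤ (geo9Y x).M → ∀ α₀ : ℝ, 0 < α₀ → (geo9Y x).M * α₀ ≤ a12 → ∀ U : (bg9YR (Matrix (Fin N) (Fin N) ℂ) (specialUnitaryUnits (Fin N)) R₁ R₂ x).Cfg, (bg9YR (Matrix (Fin N) (Fin N) ℂ) (specialUnitaryUnits (Fin N)) R₁ R₂ x).Reg335 c α₀ U →
      (bg9YR (Matrix (Fin N) (Fin N) ℂ) (specialUnitaryUnits (Fin N)) R₁ R₂ x).Reg336 c α₀ U → ∀ β' : ℝ, 0 ≤ β' → β' < 1 →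
        HasMajorantHom (g := toB6 (geo9Y x) 1 (H12 x)) (𝔬12 x).blkY (𝔭A x).blkPX ((𝔭A x).ΦX U β' ∘ₗ ((𝔬12 x).G0 U ∘ₗ (𝔬12 x).Dstar U))
          (fun (a b : (geo9Y x).Site) => Bh12 β' * (geo9Y x).len a ^ (1 - β') * Real.exp (-(δ12₀ * (geo9Y x).dist a b)))) :
    ∃ (MD KX : ℝ), M12 ≤ MD ∧ 0 ≤ KX ∧
      ∀ x : MemberY θ.d₆ θ.ℓ₆ θ.hd' θ.hL' θ.b₀ θ.b₁ Mstar, MD ≤ (geo9Y x).M → ∀ α₀ : ℝ, 0 < α₀ → (geo9Y x).M * α₀ ≤ a12 → ∀ U : (bg9YR (Matrix (Fin N) (Fin N) ℂ) (specialUnitaryUnits (Fin N)) R₁ R₂ x).Cfg, (bg9YR (Matrix (Fin N) (Fin N) ℂ) (specialUnitaryUnits (Fin N)) R₁ R₂ x).Reg335 c α₀ U → (bg9YR (Matrix (Fin N) (Fin N) ℂ) (specialUnitaryUnits (Fin N)) R₁ R₂ x).Reg336 c α₀ U →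
        ∀ β' : ℝ, 0 ≤ β' → β' < 1 →
          HasMaj (cNormR 1 (H12 x) (𝔬12 x).blkW (fun y => (geo9Y_len_pos x y).le) 0) (cNormR 1 (H12 x) (𝔭A x).blkPX (fun y => (geo9Y_len_pos x y).le) (β' - 1))
            (((𝔭A x).ΦX U β' ∘ₗ (𝔬12 x).G0 U) ∘ₗ (𝔬12 x).Dv U) (fun a b => KX * Bh12 β' * Real.exp (-(δ12₃ * (geo9Y x).dist a b))) := by
  -- a [4] (2.61) row sum at rate 1 (only its constant enters)
  obtain ⟨ML, cL, hrowL⟩ := rowSum261_geo9Y (d := θ.d₆) (ℓ := θ.ℓ₆) (hd := θ.hd') (hL := θ.hL') (b₀ := θ.b₀) (b₁ := θ.b₁) (Mstar := Mstar) 1 one_pos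
  have hrow : ∀ x : MemberY θ.d₆ θ.ℓ₆ θ.hd' θ.hL' θ.b₀ θ.b₁ Mstar, ML ≤ (geo9Y x).M → RowSum (toB6 (geo9Y x) 1 (H12 x)) 1 (max cL 0) :=
    fun x hM y => (hrowL x hM y).trans (le_max_left _ _)
  set CJ : ℝ := cR39 (trBasis N) * Real.exp ((δ12₀ + 1) * rJ θ.d₆ θ.ℓ₆) with hCJ
  have hCJ0 : 0 ≤ CJ := mul_nonneg (cR39_nonneg _) (Real.exp_nonneg _)
  have hc0 : 0 ≤ max cL 0 := le_max_right _ _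
  set KX : ℝ := ((θ.d₆ : ℝ) + 1) * CJ * max cL 0 with hKX
  have hKX0 : 0 ≤ KX := by positivity
  have hδJ : (0 : ℝ) ≤ δ12₀ + 1 := by linarith
  have hδ₃J : δ12₃ + 1 ≤ δ12₀ + 1 := by linarith
  refine ⟨max M12 ML, KX, le_max_left _ _, hKX0, fun x hM α₀ hα ha U hU hU' β' h0 h1 => ?_⟩
  letI : Fintype (geo9K x.toKIdx).Site := (inferInstance : Fintype (geo9Y x).Site)
  have hM12x : M12 ≤ (geo9Y x).M := (le_max_left _ _).trans hM
  have hMLx : ML ≤ (geo9Y x).M := (le_max_right _ _).trans hM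
  have hUG : ∀ μ z, (fun U : (bg9YR (Matrix (Fin N) (Fin N) ℂ) (specialUnitaryUnits (Fin N)) R₁ R₂ x).Cfg => U) U μ z ∈ specialUnitaryUnits (Fin N) :=
    fun μ z => mem_of_reg335R hGR x hU μ z
  have hrowx := hrow x hMLx
  have hG : GeoOK (geo9Y x) := ⟨geo9Y_dist_triangle x, geo9Y_dist_comm x, geo9K_dist_nonneg x.toKIdx, geo9Y_len_pos x⟩
  have hΦX : ∀ β' : ℝ, (𝔭A x).ΦX U β' = probeK (trBasis N) (fun b b' : FBondY x.toKIdx => parB x U b.src b'.src)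
      ((fun β' => wKA x.toKIdx β') β') ((fun β' => w₀K x.toKIdx β') β') := fun β' => by rw [h𝔭A x]; rfl
  have hPX : (𝔭A x).blkPX = blkPK (bI x) := by rw [h𝔭A x]; rfl
  exact pXDv_pinsB x (hβ1 x) (B := bg9YR (Matrix (Fin N) (Fin N) ℂ) (specialUnitaryUnits (Fin N)) R₁ R₂ x) (cfg := fun U => U) (U := U) hUG hG hrowx
    (𝔬12 x) (𝔭A x) (O x) (bP := bI x) (fun b b' : FBondY x.toKIdx => parB x U b.src b'.src) (fun β' => wKA x.toKIdx β') (fun β' => w₀K x.toKIdx β')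
    (hblk12 x) (hblkY12 x) (hblkW12 x) (hG0co12 x U) (hDsco12 x U) (hDvco12 x U) (hDds x U) (hΦX β') hPX
    (Bh := Bh12 β') (δ₀ := δ12₀) (δJ := δ12₀ + 1) (Bx := KX * Bh12 β') (δ₃ := δ12₃) (hBh12 β' h0 h1) hδJ hδ30 hδ₃₀ hδ₃J (le_of_eq (by rw [hKX, hCJ]; ring))
    (h43R x hM12x α₀ hα ha U hU hU' β' h0 h1)

end Summit.QuantumFields.YangMills.BalabanUVNodes.N06DvLettersLegAtPinsPU

end
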